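import Summits.BirchSwinnertonDyer.BirchSwinnertonDyer.Theorems.PrintCf2SplitBadTwoMordellWeilCMLatticeAlgebra
import Summits.BirchSwinnertonDyer.BirchSwinnertonDyer.Theorems.PrintCf2SplitBadTwoCMShaConjugationSwap
import Summits.BirchSwinnertonDyer.BirchSwinnertonDyer.Theorems.PrintCf2SplitBadTwoLineNoSplitPrimes
import Literature.NumberTheory.EllipticCurves.KatoTwistedFinitenessKummerDescentProofs
import Literature.NumberTheory.EllipticCurves.SelmerCorankProofs
import HarnessLib

/-!
# Crux `PrintCf2.SplitBadTwoRankOneOfFacts` (stmt-BirchSwinnertonDyer-20368), road α v10.3 — S3c (R-BV) factor (F1), GLOBAL HALF, file 2: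
# THE FRAME INSTANTIATION — complex conjugation `c` and the CM endomorphism `f = π` ON THE `K`-POINTS `E(K)`, with `cπ = π̄c`, `E(K)^c = E(ℚ)`

Cell `bsd-print-cf2`, width seat `bsd-line-cf2-p1-w6` g3 (prover-bsd-line-cf2-p1-w6-g3-0). `--supports stmt-BirchSwinnertonDyer-20368`
(helper, Theses-free). HONEST FRAMING: nothing here closes the crux or a registered stub; BSD is not proved by any of this; no summit
statement is proved by this seat. No definition, no named fact, no `sorry`.

WHAT. File 1 (`…MordellWeilCMLatticeAlgebra`, p672763) proved the Mordell–Weil algebra of a CM twist over `K` ABSTRACTLY in data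
`(A, f, c, P)`. This file SUPPLIES the data on `A = E(K) = (W.baseChange K).toAffine.Point` for `W/ℚ` and `K` imaginary quadratic:
* §1 `c` = `Affine.Point.map σ` for the non-trivial `σ ∈ Aut(K/ℚ)`: an involution (`conj_conj`), fixing the base change `P_K` of every
  `P ∈ W(ℚ)` (`conj_baseChange`), and **`exists_eq_baseChange_of_conj_eq`**: a `c`-fixed `K`-point is the base change of a `ℚ`-point
  (Galois descent on coordinates: `K^σ = ℚ`); hence `hfix` from the frame's «`∀ R ∈ W(ℚ), R = kP + T`» (`conj_fixed_eq_zsmul_add`).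
* §2 `f` = the CM endomorphism `π ∈ End_K(E_K)` DESCENDED to `E(K)` through `toGeomPoints` (`exists_descent_of_endRing`: `∃ f : E(K) →+ E(K)`,
  `toGeomPoints (f y) = π (toGeomPoints y)`; Galois descent `exists_toGeomPoints_eq_of_forall_smul_eq`), with `f (f y) = f y − 2y` from `π² = π − 2`.
* §3 **`exists_conj_anticommuting`** — `cπ = π̄c` ON `E(K)`: with -w8's conjugating lift (`exists_conjugating_lift`: `τ` lifting some
  `σ' ∈ Aut(K/ℚ)` with `π(τQ) = τQ − τ(πQ)` on `E(K̄)`) and `IsLiftOfAut.pointsMap_toGeomPoints'`: `c (f y) = c y − f (c y)`; `σ' ≠ 1`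
  (else `2π = 1` on `E[2] ≠ 0`).
* §4 **`mordellWeilCM_data_of_frame`** — everything packaged on the S3c frame: `∃ f c`, the five relations of file 1, for `P_K` the base change of
  the frame's ℚ-generator `P`; COROLLARIES by file 1: **`seven_smul_mem_of_frame`** (`7·E(K) ⊆ ℤP_K + ℤπP_K + tors`),
  **`independent_of_frame`**, **`not_exists_piSub_eq_pow_smul_of_frame`** ((INF) in lattice form).
presearch: Gross 1991 §5 (5.1) (complex conjugation vs Heegner points / CM), Rubin LNM 1716 §2–§3, Silverman AEC VIII §1 (descent) — held;
no fact filed. beyond-print theorem: no (bookkeeping).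

References: [GrossLMS1991] §5 (5.1); [Rubin1999] §2–§3; [SilvermanAEC2009] VIII §1; [SilvermanATAEC1994] II §2 Thm. 2.2(b).
-/

noncomputable section

open scoped Classical

set_option linter.dupNamespace false
set_option autoImplicit false

namespace Summit.BirchSwinnertonDyer.BirchSwinnertonDyer.Theorems.PrintCf2.MordellWeilCM

open NumberField Field WeierstrassCurve
open Literature.NumberTheory.EllipticCurves Literature.NumberTheory.GaloisRepresentations
open Summit.BirchSwinnertonDyer.BirchSwinnertonDyer.Theorems.PrintCf2.LineDecomposition

variable (W : WeierstrassCurve ℚ) (K : Type) [Field K] [NumberField K]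

/-! ## §1. Complex conjugation on `E(K)`: involution, fixes base-changed ℚ-points, and its fixed points come from `E(ℚ)` -/

/-- For `σ ∈ Aut(K/ℚ)` of a quadratic field with `σ ≠ 1`: `σ² = 1`. [folklore] -/
theorem algEquiv_mul_self_eq_one (hK2 : Module.finrank ℚ K = 2) {σ : K ≃ₐ[ℚ] K} (hσ : σ ≠ 1) : σ * σ = 1 :=
  (eq_one_or_eq_of_finrank_eq_two hK2 hσ (σ * σ)).elim id fun h ↦ absurd (mul_left_cancel (h.trans (mul_one σ).symm)) hσ

/-- `c := Point.map σ` is an involution on `E(K)` when `σ² = 1`. [folklore] -/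
theorem conj_conj {σ : K ≃ₐ[ℚ] K} (hσσ : σ * σ = 1) (y : (W.baseChange K).toAffine.Point) :
    Affine.Point.map (W' := W.toAffine) (σ : K →ₐ[ℚ] K) (Affine.Point.map (W' := W.toAffine) (σ : K →ₐ[ℚ] K) y) = y := by
  have hx : ∀ x : K, σ (σ x) = x := fun x ↦ by
    have := congrArg (fun τ : K ≃ₐ[ℚ] K ↦ τ x) hσσ
    simpa using this
  rcases y with _ | ⟨x, y, h⟩
  · rfl
  · rw [Affine.Point.map_some, Affine.Point.map_some]
    exact Affine.Point.some_eq_some_of_eq (hx x) (hx y)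

/-- `c` fixes the base change `P_K` of every ℚ-point `P` (`σ ∘ (ℚ → K) = (ℚ → K)`). [folklore] -/
theorem conj_baseChange (σ : K ≃ₐ[ℚ] K) (P : W.toAffine.Point) :
    Affine.Point.map (W' := W.toAffine) (σ : K →ₐ[ℚ] K) (Affine.Point.map (W' := W.toAffine) (Algebra.ofId ℚ K) P) =
      Affine.Point.map (W' := W.toAffine) (Algebra.ofId ℚ K) P := by
  rw [Affine.Point.map_map]
  have h : (σ : K →ₐ[ℚ] K).comp (Algebra.ofId ℚ K) = Algebra.ofId ℚ K := Subsingleton.elim _ _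
  rw [h]

/-- **Galois descent on coordinates**: in a quadratic field, an element fixed by the non-trivial automorphism is rational. [folklore] -/
theorem mem_range_algebraMap_of_fixed (hK2 : Module.finrank ℚ K = 2) {σ : K ≃ₐ[ℚ] K} (hσ : σ ≠ 1) {x : K} (hx : σ x = x) :
    x ∈ Set.range (algebraMap ℚ K) := by
  haveI : Algebra.IsQuadraticExtension ℚ K := ⟨hK2⟩
  haveI : IsGalois ℚ K := inferInstance
  have hall : ∀ τ : K ≃ₐ[ℚ] K, τ x = x := fun τ ↦ by
    rcases eq_one_or_eq_of_finrank_eq_two hK2 hσ τ with rfl | rfl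
    · rfl
    · exact hx
  have hmem : x ∈ IntermediateField.fixedField (⊤ : Subgroup (K ≃ₐ[ℚ] K)) := fun τ ↦ hall τ
  rw [IsGalois.fixedField_top] at hmem
  exact IntermediateField.mem_bot.mp hmem

/-- **`E(K)^c ⊆ E(ℚ)`**: a `K`-point fixed by `c = Point.map σ` (`σ ≠ 1`) is the base change of a ℚ-point. [cite: SilvermanAEC2009, VIII §1] -/
theorem exists_eq_baseChange_of_conj_eq (hK2 : Module.finrank ℚ K = 2) {σ : K ≃ₐ[ℚ] K} (hσ : σ ≠ 1)
    {y : (W.baseChange K).toAffine.Point} (hy : Affine.Point.map (W' := W.toAffine) (σ : K →ₐ[ℚ] K) y = y) :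
    ∃ R : W.toAffine.Point, Affine.Point.map (W' := W.toAffine) (Algebra.ofId ℚ K) R = y := by
  rcases y with _ | ⟨x, y, h⟩
  · exact ⟨0, rfl⟩
  · rw [Affine.Point.map_some] at hy
    obtain ⟨hx, hy'⟩ := Affine.Point.some.inj hy
    obtain ⟨x₀, rfl⟩ := mem_range_algebraMap_of_fixed K hK2 hσ hx
    obtain ⟨y₀, rfl⟩ := mem_range_algebraMap_of_fixed K hK2 hσ hy'
    have h₀ : (W.toAffine.baseChange ℚ).Nonsingular x₀ y₀ :=
      ((W.toAffine).baseChange_nonsingular (f := Algebra.ofId ℚ K) (algebraMap ℚ K).injective x₀ y₀).mp h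
    exact ⟨(.some x₀ y₀ h₀ : (W.toAffine.baseChange ℚ).Point), by
      rw [Affine.Point.map_some]; exact Affine.Point.some_eq_some_of_eq rfl rfl⟩

/-- **`hfix` on the frame**: if every ℚ-point is `kP + T`, then every `c`-fixed `K`-point is `k • P_K +` torsion. [cite: SilvermanAEC2009, VIII §1] -/
theorem conj_fixed_eq_zsmul_add (hK2 : Module.finrank ℚ K = 2) {σ : K ≃ₐ[ℚ] K} (hσ : σ ≠ 1) {P : W.toAffine.Point}
    (hgen : ∀ R : W.toAffine.Point, ∃ (k : ℤ) (T : W.toAffine.Point), IsOfFinAddOrder T ∧ R = k • P + T)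
    (y : (W.baseChange K).toAffine.Point) (hy : Affine.Point.map (W' := W.toAffine) (σ : K →ₐ[ℚ] K) y = y) :
    ∃ (k : ℤ) (T : (W.baseChange K).toAffine.Point), IsOfFinAddOrder T ∧
      y = k • Affine.Point.map (W' := W.toAffine) (Algebra.ofId ℚ K) P + T := by
  obtain ⟨R, rfl⟩ := exists_eq_baseChange_of_conj_eq W K hK2 hσ hy
  obtain ⟨k, T, hT, hR⟩ := hgen R
  refine ⟨k, Affine.Point.map (W' := W.toAffine) (Algebra.ofId ℚ K) T,
    (Affine.Point.map (W' := W.toAffine) (Algebra.ofId ℚ K)).isOfFinAddOrder hT, ?_⟩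
  have e : Affine.Point.map (W' := W.toAffine) (Algebra.ofId ℚ K) R =
      Affine.Point.map (W' := W.toAffine) (Algebra.ofId ℚ K) (k • P + T) := congrArg _ hR
  refine e.trans ?_
  exact ((Affine.Point.map (W' := W.toAffine) (Algebra.ofId ℚ K)).map_add (k • P) T).trans
    (congrArg (· + _) ((Affine.Point.map (W' := W.toAffine) (Algebra.ofId ℚ K)).map_zsmul k P))

/-- The base change of a point of infinite order has infinite order (`Point.map` is injective). [folklore] -/
theorem not_isOfFinAddOrder_baseChange {P : W.toAffine.Point} (hP : ¬ IsOfFinAddOrder P) :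
    ¬ IsOfFinAddOrder (Affine.Point.map (W' := W.toAffine) (Algebra.ofId ℚ K) P) := by
  intro h
  apply hP
  obtain ⟨n, hn, hn0⟩ := (isOfFinAddOrder_iff_nsmul_eq_zero).mp h
  refine (isOfFinAddOrder_iff_nsmul_eq_zero).mpr ⟨n, hn, ?_⟩
  have e : Affine.Point.map (W' := W.toAffine) (Algebra.ofId ℚ K) (n • P) = 0 :=
    ((Affine.Point.map (W' := W.toAffine) (Algebra.ofId ℚ K)).map_nsmul n P).trans hn0
  exact Affine.Point.map_injective (W' := W.toAffine) (f := Algebra.ofId ℚ K) (e.trans (map_zero _).symm)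

/-! ## §2. The CM endomorphism on `E(K)`: descent of `π ∈ End_K(E_K)` through `E(K) ↪ E(K̄)` -/

/-- **Descent of a `K`-rational endomorphism to the `K`-points.** For `π ∈ End_K(E_K)` (`(W.baseChange K).endRing`: algebraic and
`Γ_K`-equivariant on `E(K̄)`), there is an additive `f : E(K) → E(K)` with `toGeomPoints (f y) = π (toGeomPoints y)`: `π` of a `K`-point
is `Γ_K`-fixed, hence a `K`-point (Galois descent `exists_toGeomPoints_eq_of_forall_smul_eq`); additivity by injectivity of `E(K) ↪ E(K̄)`.
[cite: SilvermanAEC2009, VIII §1] -/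
theorem exists_descent_of_endRing (π : (W.baseChange K).endRing) :
    ∃ f : (W.baseChange K).toAffine.Point →+ (W.baseChange K).toAffine.Point,
      ∀ y, toGeomPoints (W.baseChange K) (f y) =
        (π : AddMonoid.End (W.baseChange K).geomPoints) (toGeomPoints (W.baseChange K) y) := by
  have hequiv := ((W.baseChange K).mem_equivariantSubring_iff (π : AddMonoid.End (W.baseChange K).geomPoints)).1
    (Subring.mem_inf.1 π.2).2
  have hex : ∀ y : (W.baseChange K).toAffine.Point, ∃ y' : (W.baseChange K).toAffine.Point,
      toGeomPoints (W.baseChange K) y' = (π : AddMonoid.End (W.baseChange K).geomPoints) (toGeomPoints (W.baseChange K) y) :=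
    fun y ↦ exists_toGeomPoints_eq_of_forall_smul_eq (W.baseChange K) fun σ ↦ by rw [← hequiv, smul_toGeomPoints]
  choose g hg using hex
  refine ⟨{ toFun := g, map_zero' := ?_, map_add' := ?_ }, hg⟩
  · apply toGeomPoints_injective (W.baseChange K)
    rw [hg, map_zero, map_zero]
  · intro a b
    apply toGeomPoints_injective (W.baseChange K)
    rw [hg, map_add, map_add, map_add, hg, hg]

/-- The descended `f` inherits `π² = π − 2`: `f (f y) = f y − 2 • y`. [cite: Rubin1999, §3] -/
theorem descent_rel {π : (W.baseChange K).endRing} (hrel : (π : AddMonoid.End (W.baseChange K).geomPoints) * π = π - 2)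
    {f : (W.baseChange K).toAffine.Point →+ (W.baseChange K).toAffine.Point}
    (hf : ∀ y, toGeomPoints (W.baseChange K) (f y) = (π : AddMonoid.End (W.baseChange K).geomPoints) (toGeomPoints (W.baseChange K) y))
    (y : (W.baseChange K).toAffine.Point) : f (f y) = f y - 2 • y := by
  apply toGeomPoints_injective (W.baseChange K)
  rw [hf, hf, map_sub, map_nsmul, hf,
    Summit.BirchSwinnertonDyer.BirchSwinnertonDyer.Theorems.PrintCf2.CMPrimes.cmEndo_apply_apply (W.baseChange K) hrel]

/-! ## §3. `cπ = π̄c` on `E(K)` from the conjugating lift -/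

/-- **`c (f y) = c y − f (c y)` on `E(K)`** for `c = Point.map σ'` and a lift `τ` of `σ'` anti-commuting with `π` on `E(K̄)`
(`π(τQ) = τQ − τ(πQ)`), `f` the descent of `π`: read `τ` on `K`-points through `IsLiftOfAut.pointsMap_toGeomPoints'`.
[cite: GrossLMS1991, §5 (5.1)] -/
theorem conj_descent_eq {σ' : K ≃ₐ[ℚ] K} {τ : AlgebraicClosure K ≃+* AlgebraicClosure K} (hτ : IsLiftOfAut σ' τ)
    {π : (W.baseChange K).endRing}
    (hanti : ∀ Q, (π : AddMonoid.End (W.baseChange K).geomPoints) (hτ.pointsMap W Q) =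
      hτ.pointsMap W Q - hτ.pointsMap W ((π : AddMonoid.End (W.baseChange K).geomPoints) Q))
    {f : (W.baseChange K).toAffine.Point →+ (W.baseChange K).toAffine.Point}
    (hf : ∀ y, toGeomPoints (W.baseChange K) (f y) = (π : AddMonoid.End (W.baseChange K).geomPoints) (toGeomPoints (W.baseChange K) y))
    (y : (W.baseChange K).toAffine.Point) :
    Affine.Point.map (W' := W.toAffine) (σ' : K →ₐ[ℚ] K) (f y) =
      Affine.Point.map (W' := W.toAffine) (σ' : K →ₐ[ℚ] K) y - f (Affine.Point.map (W' := W.toAffine) (σ' : K →ₐ[ℚ] K) y) := by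
  apply toGeomPoints_injective (W.baseChange K)
  have h1 := IsLiftOfAut.pointsMap_toGeomPoints' W hτ (f y)
  have h2 := IsLiftOfAut.pointsMap_toGeomPoints' W hτ y
  rw [← h1, map_sub, hf, ← h2, hf]
  -- `τ(πQ) = τQ − π(τQ)` from `hanti`
  have h3 := hanti (toGeomPoints (W.baseChange K) y)
  rw [h2] at h3 ⊢
  rw [h3]
  abel

/-- **The conjugating `σ'` is NOT the identity**: if `σ' = 1` then the lift `τ` fixes `K`, i.e. is an element `g ∈ Γ_K`, with `τQ = g • Q`;
`π` commutes with `g`, so anti-commutation gives `2 • π Q = Q` for all `Q ∈ E(K̄)`, absurd at a non-zero `2`-torsion point.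
[cite: GrossLMS1991, §5 (5.1)] -/
theorem conj_ne_one [W.IsElliptic] {σ' : K ≃ₐ[ℚ] K} {τ : AlgebraicClosure K ≃+* AlgebraicClosure K} (hτ : IsLiftOfAut σ' τ)
    {π : (W.baseChange K).endRing}
    (hanti : ∀ Q, (π : AddMonoid.End (W.baseChange K).geomPoints) (hτ.pointsMap W Q) =
      hτ.pointsMap W Q - hτ.pointsMap W ((π : AddMonoid.End (W.baseChange K).geomPoints) Q)) :
    σ' ≠ 1 := by
  intro h1
  subst h1
  -- `τ` is `K`-linear: an element of `Γ_K`
  let g : Field.absoluteGaloisGroup K := { τ with commutes' := fun x ↦ hτ x }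
  have hg : ∀ Q : (W.baseChange K).geomPoints, hτ.pointsMap W Q = g • Q := by
    intro Q
    change ((W.baseChange K).baseChange (AlgebraicClosure K)).toAffine.Point at Q
    rcases Q with _ | ⟨x, y, h⟩
    · rfl
    · exact Affine.Point.some_eq_some_of_eq rfl rfl
  have hequiv := ((W.baseChange K).mem_equivariantSubring_iff (π : AddMonoid.End (W.baseChange K).geomPoints)).1
    (Subring.mem_inf.1 π.2).2
  -- `2 • π Q = Q` for every `Q`
  have htwo : ∀ Q : (W.baseChange K).geomPoints, (2 : ℕ) • (π : AddMonoid.End (W.baseChange K).geomPoints) Q = Q := by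
    intro Q
    have h := hanti Q
    rw [hg, hg, hequiv, eq_sub_iff_add_eq] at h
    -- `g • πQ + g • πQ = g • Q`
    have h' : g • ((2 : ℕ) • (π : AddMonoid.End (W.baseChange K).geomPoints) Q) = g • Q := by
      rw [two_nsmul, smul_add]; exact h
    have h'' := congrArg (fun P ↦ g⁻¹ • P) h'
    simpa only [inv_smul_smul] using h''
  -- a non-zero `2`-torsion point
  have h4 : Nat.card ((W.baseChange K).geomTorsion (2 : ℤ)) = 2 ^ (2 * 1) := by
    have := card_geomTorsion_two_pow (W.baseChange K) (two_ne_zero) 1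
    simpa using this
  haveI : Finite ((W.baseChange K).geomTorsion (2 : ℤ)) := Nat.finite_of_card_ne_zero (by rw [h4]; norm_num)
  have hnt : Nontrivial ((W.baseChange K).geomTorsion (2 : ℤ)) := by
    rw [← Finite.one_lt_card_iff_nontrivial, h4]; norm_num
  obtain ⟨Q, hQ⟩ := exists_ne (0 : (W.baseChange K).geomTorsion (2 : ℤ))
  apply hQ
  have hQ2 : (2 : ℤ) • (Q : (W.baseChange K).geomPoints) = 0 := Q.2
  apply Subtype.ext
  change (Q : (W.baseChange K).geomPoints) = 0
  rw [← htwo (Q : (W.baseChange K).geomPoints), ← map_nsmul]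
  have : (2 : ℕ) • (Q : (W.baseChange K).geomPoints) = 0 := by
    rw [← natCast_zsmul]; exact_mod_cast hQ2
  rw [this, map_zero]

/-! ## §4. The package on the S3c frame, and the Mordell–Weil corollaries -/

/-- **THE DATA `(E(K), π, c, P_K)` OF FILE 1 ON THE FRAME.** `W/ℚ` elliptic, `K` imaginary quadratic, `π ∈ End_K(E_K)` with `π² = π − 2`,
`P ∈ W(ℚ)` of infinite order generating `W(ℚ)` modulo torsion. Then there are additive `f, c : E(K) → E(K)` with: `f` the descent of `π`;
`f (f y) = f y − 2y`; `c (c y) = y`; `c (f y) = c y − f (c y)`; `c P_K = P_K`; `P_K` of infinite order; and every `c`-fixed `K`-point is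
`k • P_K +` torsion — `P_K` the base change of `P`. [cite: GrossLMS1991, §5 (5.1)] [cite: Rubin1999, §2–§3] [cite: SilvermanAEC2009, VIII §1] -/
theorem mordellWeilCM_data [W.IsElliptic] (hK : IsImaginaryQuadratic K)
    (π : (W.baseChange K).endRing) (hrel : (π : AddMonoid.End (W.baseChange K).geomPoints) * π = π - 2)
    {P : W.toAffine.Point} (hP : ¬ IsOfFinAddOrder P)
    (hgen : ∀ R : W.toAffine.Point, ∃ (k : ℤ) (T : W.toAffine.Point), IsOfFinAddOrder T ∧ R = k • P + T) :
    ∃ f c : (W.baseChange K).toAffine.Point →+ (W.baseChange K).toAffine.Point,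
      (∀ y, toGeomPoints (W.baseChange K) (f y) = (π : AddMonoid.End (W.baseChange K).geomPoints) (toGeomPoints (W.baseChange K) y)) ∧
      (∀ y, f (f y) = f y - 2 • y) ∧ (∀ y, c (c y) = y) ∧ (∀ y, c (f y) = c y - f (c y)) ∧
      c (Affine.Point.map (W' := W.toAffine) (Algebra.ofId ℚ K) P) = Affine.Point.map (W' := W.toAffine) (Algebra.ofId ℚ K) P ∧
      ¬ IsOfFinAddOrder (Affine.Point.map (W' := W.toAffine) (Algebra.ofId ℚ K) P) ∧
      ∀ y, c y = y → ∃ (k : ℤ) (T : (W.baseChange K).toAffine.Point), IsOfFinAddOrder T ∧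
        y = k • Affine.Point.map (W' := W.toAffine) (Algebra.ofId ℚ K) P + T := by
  haveI : Algebra.IsQuadraticExtension ℚ K := ⟨hK.1⟩
  haveI : IsGalois ℚ K := inferInstance
  haveI : Normal ℚ K := inferInstance
  -- the CM endomorphism as an isogeny, and the conjugating lift
  have hπ : (π : AddMonoid.End (W.baseChange K).geomPoints) ∈ (W.baseChange K).geomEndRing := (Subring.mem_inf.1 π.2).1
  have hequiv := ((W.baseChange K).mem_equivariantSubring_iff (π : AddMonoid.End (W.baseChange K).geomPoints)).1
    (Subring.mem_inf.1 π.2).2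
  obtain ⟨φ, hφ, hφrel⟩ := Summit.BirchSwinnertonDyer.BirchSwinnertonDyer.Theorems.PrintCf2.CMPrimes.exists_isogeny_apply_eq_cmEndo
    (W.baseChange K) hπ hequiv hrel
  obtain ⟨σ', τ, hτ, hantiφ⟩ :=
    Summit.BirchSwinnertonDyer.BirchSwinnertonDyer.Theorems.PrintCf2.CMPrimes.exists_conjugating_lift W K φ hφrel
  have hanti : ∀ Q, (π : AddMonoid.End (W.baseChange K).geomPoints) (hτ.pointsMap W Q) =
      hτ.pointsMap W Q - hτ.pointsMap W ((π : AddMonoid.End (W.baseChange K).geomPoints) Q) := fun Q ↦ by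
    rw [← hφ, ← hφ]; exact hantiφ Q
  have hσ' : σ' ≠ 1 := conj_ne_one W K hτ hanti
  obtain ⟨f, hf⟩ := exists_descent_of_endRing W K π
  refine ⟨f, Affine.Point.map (W' := W.toAffine) (σ' : K →ₐ[ℚ] K), hf, descent_rel W K hrel hf,
    conj_conj W K (algEquiv_mul_self_eq_one K hK.1 hσ'), conj_descent_eq W K hτ hanti hf, conj_baseChange W K σ' P,
    not_isOfFinAddOrder_baseChange W K hP, fun y hy ↦ conj_fixed_eq_zsmul_add W K hK.1 hσ' hgen y hy⟩

/-- **`7 · E(K) ⊆ ℤ P_K + ℤ πP_K + E(K)_tors` ON THE FRAME** (file 1 `seven_smul_mem` on the data of `mordellWeilCM_data`): for every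
`K`-point `y` there are `a b : ℤ`, a torsion `T` and the `K`-point `P₁` with `toGeomPoints P₁ = π (toGeomPoints P_K)` such that
`7 • y = a • P_K + b • P₁ + T`. Hence `E(K) ⊗ ℤ₂ = (O_K ⊗ ℤ₂) · P_K` (memo F1-DELTAQ §2: δQ = 1). [cite: Rubin1999, §2–§3] -/
theorem seven_smul_mem_of_frame [W.IsElliptic] (hK : IsImaginaryQuadratic K)
    (π : (W.baseChange K).endRing) (hrel : (π : AddMonoid.End (W.baseChange K).geomPoints) * π = π - 2)
    {P : W.toAffine.Point} (hP : ¬ IsOfFinAddOrder P)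
    (hgen : ∀ R : W.toAffine.Point, ∃ (k : ℤ) (T : W.toAffine.Point), IsOfFinAddOrder T ∧ R = k • P + T) :
    ∃ P₁ : (W.baseChange K).toAffine.Point,
      toGeomPoints (W.baseChange K) P₁ =
        (π : AddMonoid.End (W.baseChange K).geomPoints) (toGeomPoints (W.baseChange K) (Affine.Point.map (W' := W.toAffine) (Algebra.ofId ℚ K) P)) ∧
      ∀ y : (W.baseChange K).toAffine.Point, ∃ (a b : ℤ) (T : (W.baseChange K).toAffine.Point), IsOfFinAddOrder T ∧
        (7 : ℤ) • y = a • Affine.Point.map (W' := W.toAffine) (Algebra.ofId ℚ K) P + b • P₁ + T := by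
  obtain ⟨f, c, hf, hff, hcc, hcf, hcP, -, hfix⟩ := mordellWeilCM_data W K hK π hrel hP hgen
  exact ⟨f (Affine.Point.map (W' := W.toAffine) (Algebra.ofId ℚ K) P), hf _,
    fun y ↦ seven_smul_mem f c hff hcc hcf hfix y⟩

/-- **`P_K` AND `πP_K` ARE INDEPENDENT MODULO TORSION ON THE FRAME** (file 1 `eq_zero_of_isOfFinAddOrder_smul_add_smul`).
[cite: Rubin1999, §2–§3] -/
theorem independent_of_frame [W.IsElliptic] (hK : IsImaginaryQuadratic K)
    (π : (W.baseChange K).endRing) (hrel : (π : AddMonoid.End (W.baseChange K).geomPoints) * π = π - 2)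
    {P : W.toAffine.Point} (hP : ¬ IsOfFinAddOrder P)
    (hgen : ∀ R : W.toAffine.Point, ∃ (k : ℤ) (T : W.toAffine.Point), IsOfFinAddOrder T ∧ R = k • P + T)
    {P₁ : (W.baseChange K).toAffine.Point}
    (hP₁ : toGeomPoints (W.baseChange K) P₁ =
      (π : AddMonoid.End (W.baseChange K).geomPoints) (toGeomPoints (W.baseChange K) (Affine.Point.map (W' := W.toAffine) (Algebra.ofId ℚ K) P)))
    {a b : ℤ} (h : IsOfFinAddOrder (a • Affine.Point.map (W' := W.toAffine) (Algebra.ofId ℚ K) P + b • P₁)) : a = 0 ∧ b = 0 := by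
  obtain ⟨f, c, hf, hff, hcc, hcf, hcP, hPK, -⟩ := mordellWeilCM_data W K hK π hrel hP hgen
  have e : P₁ = f (Affine.Point.map (W' := W.toAffine) (Algebra.ofId ℚ K) P) :=
    toGeomPoints_injective (W.baseChange K) (hP₁.trans (hf _).symm)
  subst e
  exact eq_zero_of_isOfFinAddOrder_smul_add_smul f c hff hcf hPK hcP h

/-- **(INF) ON THE FRAME, LATTICE FORM: `πP_K − r • P_K ∉ 2^N E(K) + E(K)_tors` for every `r : ℤ` and `N ≥ 1`** (file 1
`not_exists_fSub_eq_pow_smul`; -w3 g9's (IND)/(INF) input «π is not a scalar on `P_K` modulo `2^N E(K) +` torsion»). [cite: Rubin1999, §2–§3] -/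
theorem not_exists_piSub_eq_pow_smul_of_frame [W.IsElliptic] (hK : IsImaginaryQuadratic K)
    (π : (W.baseChange K).endRing) (hrel : (π : AddMonoid.End (W.baseChange K).geomPoints) * π = π - 2)
    {P : W.toAffine.Point} (hP : ¬ IsOfFinAddOrder P)
    (hgen : ∀ R : W.toAffine.Point, ∃ (k : ℤ) (T : W.toAffine.Point), IsOfFinAddOrder T ∧ R = k • P + T)
    {P₁ : (W.baseChange K).toAffine.Point}
    (hP₁ : toGeomPoints (W.baseChange K) P₁ =
      (π : AddMonoid.End (W.baseChange K).geomPoints) (toGeomPoints (W.baseChange K) (Affine.Point.map (W' := W.toAffine) (Algebra.ofId ℚ K) P)))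
    (r : ℤ) {N : ℕ} (hN : 1 ≤ N) :
    ¬ ∃ (y T : (W.baseChange K).toAffine.Point), IsOfFinAddOrder T ∧
      ((2 : ℤ) ^ N) • y + T = P₁ - r • Affine.Point.map (W' := W.toAffine) (Algebra.ofId ℚ K) P := by
  obtain ⟨f, c, hf, hff, hcc, hcf, hcP, hPK, hfix⟩ := mordellWeilCM_data W K hK π hrel hP hgen
  have e : P₁ = f (Affine.Point.map (W' := W.toAffine) (Algebra.ofId ℚ K) P) :=
    toGeomPoints_injective (W.baseChange K) (hP₁.trans (hf _).symm)
  subst e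
  exact not_exists_fSub_eq_pow_smul f c hff hcc hcf hPK hcP hfix r hN

end Summit.BirchSwinnertonDyer.BirchSwinnertonDyer.Theorems.PrintCf2.MordellWeilCM

end
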